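import Summits.RiemannHypothesis.RiemannHypothesis.Theorems.LiAsymptoticLawRH
import Literature.NumberTheory.LFunctions.RiemannHypothesisUpTo1000X
import HarnessLib

/-!
# THE SQUARE-ROOT LAG LAW for the Keiper–Li coefficients (monotonicity at lag `3√m`, effective; RH-free at a verified height) — SketchG13 §§1–4

Cell rh-split, seat rh-split-li-bridge g13 (brief sha16 f79c5f09d8bcb036), card `run/shared/lean/pub/rh-split/cards/SPLIT-li-bridge.md`
§20; kernel source `HOME/rh-split-li-bridge/SketchG13.lean` sha16 d141028e77b25d35 (355 l, farm rc 0 · 0 err · 0 warn · 0 sorry, std axioms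
[propext, Classical.choice, Quot.sound] on `li_lag_monotone_upTo_250000`, `li_sqrtLag_monotone_of_rh`, `rh_iff_li_sqrtLag`,
`li_lag_monotone_of_level_law`), cut by the seat as ONE file (16 theorems), decl text byte-verbatim; deltas = namespace `RhSplit.LiBridgeG13` ↦
`…Splittings.LiSqrtLagLaw`, this docstring, `set_option linter.dupNamespace false`.  Tree inputs only (cited, not re-derived): the explicit
Lagarias level law of route `LiAsymptotic` (`liAsymptoticLawQuadratic_proof`: `RiemannHypothesisUpTo T`, `T ≥ 1000`, `n ≤ T²/4` ⟹
`|λ_n − M(n)| ≤ 2√n log n` (`n ≥ 900`), `≤ (1/3)√n log n` (`n ≥ 3·10⁵`), `M(n) = liMainTerm n = (n/2) log n + C₁ n`), the hypothesis-free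
height certificate `riemannHypothesisUpTo_1000`, `RiemannHypothesisUpTo.of_riemannHypothesis`, `riemannHypothesis_of_keiperLiCoeff_bddBelow`
(Bombieri–Lagarias), `LiTheory.Budget.log_two_pi_crude`, `Real.one_half_lt_eulerMascheroniConstant`.  Standard axioms.  Zero definitions.

WHAT IS PROVED (`λ_n = keiperLiCoeff n`).  §1 elementary (`√(m+d) ≤ √m + d/(2√m)`, `j·log 2 ≤ log x`, `C₁ ≥ −5/4`).  §2 RH-FREE CORE
`li_lag_lower_bound`: an `A√n log n` law read at `m` and at `n ≥ m + c√m` gives `λ_n − λ_m ≥ (n − m)((1/2 − 2A/c − A/(2s₀)) log n + C₁)`.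
§3 THE LAW: `li_sqrtLag_monotone_of_rhUpTo : 1000 ≤ T → RiemannHypothesisUpTo T → 3·10⁵ ≤ m → m + 3√m ≤ n → n ≤ T²/4 → λ_m < λ_n`
(RH-FREE); `li_lag_monotone_upTo_250000 : 10⁴ ≤ m → m + 12√m ≤ n → n ≤ 2.5·10⁵ → λ_m < λ_n` (UNCONDITIONAL THEOREM, kernel);
`li_sqrtLag_monotone_plattTrudgian` (on the cited Platt–Trudgian height, `n ≤ 2.25·10²⁴`); `li_sqrtLag_monotone_of_rh : RH → 3·10⁵ ≤ m →
m + 3√m ≤ n → λ_m < λ_n` (RH-CONSEQUENCE, EFFECTIVE); window form `li_sqrtWindow_monotone_of_rh` (on `[N, 2N]`, every lag `≥ (9/2)√N`);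
`li_dilation_monotone_of_rh` (the dilation law `n ≥ (1+ε)m` as a corollary); `li_lag_monotone_of_level_law` (an `A`-law gives every lag
constant `c > 4A`).  §4 RH-FREE CONVERSE `rh_of_li_anchor` (ONE anchored comparison `λ_m ≤ λ_n ∀ n ≥ B` ⟹ RH), `rh_of_li_lagLaw` (EVERY lag
law ⟹ RH), RH-EQUIVALENCES `rh_iff_li_sqrtLag`, `rh_iff_li_lagLaw` (every lag function `f ≥ 3√·`) — RELABELLING.
PORTRAIT (corrects `LiMonotonicityScales`' «down to N/log²N»): «`λ_m < λ_n` for `n ≥ m + k(m)`» is an RH-EQUIVALENCE in kernel for every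
lag `k(m) ≥ 3√m`, `⟹ RH` for every lag whatsoever, and «RH ⟹ it» is OPEN for every `k = o(√m)` down to `k = 1` (the in-print «λ_n increasing»
conjecture, Omar–Ouni–Mazhouda 2011); absolute-value readings of the low zeros certify nothing below lag `≍ √m` (card §20.2).  In print: NULL
(corpus fts + vec, galaxy; card §20.4).

HONEST LABEL: «SPLITTING SEARCH over kernel-typed RH-EQUIVALENCES; a splitting A ∧ B ⟹ RH is CONDITIONAL bookkeeping unless A and B are
both proved; nothing here bears on the truth of RH.»  Every theorem below is an RH-CONSEQUENCE (`RiemannHypothesis → …`), an RH-FREE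
implication (`… → RiemannHypothesis`, `RiemannHypothesisUpTo T → …`), an UNCONDITIONAL inequality, or an RH-EQUIVALENCE labelled RELABELLING
(neither side asserted); none is a claim about RH.
-/

set_option linter.dupNamespace false

namespace Summit.RiemannHypothesis.RiemannHypothesis.Theorems.Splittings.LiSqrtLagLaw

open Literature.NumberTheory.LFunctions Literature.NumberTheory.DiophantineGeometry
open Summit.RiemannHypothesis.RiemannHypothesis.Theorems.LiTheory

/-! ## §1 Elementary inequalities -/

/-- Concavity of the square root in the form used below: `√(m + d) ≤ √m + d/(2√m)` (`m > 0`, `d ≥ 0`). -/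
theorem sqrt_add_le_sqrt_add_div {m d : ℝ} (hm : 0 < m) (hd : 0 ≤ d) :
    Real.sqrt (m + d) ≤ Real.sqrt m + d / (2 * Real.sqrt m) := by
  have hs : 0 < Real.sqrt m := Real.sqrt_pos.2 hm
  have hss : Real.sqrt m ^ 2 = m := Real.sq_sqrt hm.le
  have hst : 2 * Real.sqrt m * (d / (2 * Real.sqrt m)) = d := by field_simp
  have ht0 : 0 ≤ d / (2 * Real.sqrt m) := by positivity
  have hsq : m + d ≤ (Real.sqrt m + d / (2 * Real.sqrt m)) ^ 2 := by
    nlinarith [sq_nonneg (d / (2 * Real.sqrt m))]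
  calc Real.sqrt (m + d) ≤ Real.sqrt ((Real.sqrt m + d / (2 * Real.sqrt m)) ^ 2) := Real.sqrt_le_sqrt hsq
    _ = Real.sqrt m + d / (2 * Real.sqrt m) := Real.sqrt_sq (by positivity)

/-- `j · 0.6931471803 ≤ log x` whenever `2 ^ j ≤ x` (`log 2 > 0.6931471803`). -/
theorem mul_log_two_le_log {j : ℕ} {x : ℝ} (hx : (2 : ℝ) ^ j ≤ x) : (j : ℝ) * 0.6931471803 ≤ Real.log x := by
  have h2 : (0 : ℝ) < 2 ^ j := by positivity
  have hlog : Real.log ((2 : ℝ) ^ j) ≤ Real.log x := Real.log_le_log h2 hx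
  rw [Real.log_pow] at hlog
  have hl2 := Real.log_two_gt_d9
  have hj : (0 : ℝ) ≤ j := Nat.cast_nonneg j
  nlinarith [mul_le_mul_of_nonneg_left hl2.le hj]

/-- `C₁ = (γ − 1 − log 2π)/2 ≥ −5/4` (`γ > 1/2`, `log 2π ≤ 2`; cf. the tree twins `LiTheory.liC1_ge`,
`Splittings.LiIncrHighPart.liC1_ge`). -/
private theorem neg_five_fourths_le_liC1 : -(5 / 4 : ℝ) ≤ liC1 := by
  have hγ := Real.one_half_lt_eulerMascheroniConstant
  obtain ⟨-, h2⟩ := Summit.RiemannHypothesis.RiemannHypothesis.Theorems.LiTheory.Budget.log_two_pi_crude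
  unfold liC1
  linarith

/-- `s₀ ≤ √m` from `s₀² ≤ m` (`s₀ ≥ 0`). -/
theorem le_sqrt_of_sq_le {s₀ : ℝ} {m : ℝ} (hs₀ : 0 ≤ s₀) (h : s₀ ^ 2 ≤ m) : s₀ ≤ Real.sqrt m := by
  calc s₀ = Real.sqrt (s₀ ^ 2) := (Real.sqrt_sq hs₀).symm
    _ ≤ Real.sqrt m := Real.sqrt_le_sqrt h

/-! ## §2 The RH-free core: two readings of an `A√n log n` level law give a lag-`c√m` comparison -/

/-- **RH-FREE CORE (pure real analysis).** If `|λ_m − M(m)| ≤ A√m log m` and `|λ_n − M(n)| ≤ A√n log n` with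
`1 ≤ m`, `0 < s₀ ≤ √m`, `0 < c` and `m + c√m ≤ n`, then
`(n − m)·((1/2 − 2A/c − A/(2s₀))·log n + C₁) ≤ λ_n − λ_m`.
Proof: `M(n) − M(m) ≥ (n − m)(½ log n + C₁)`; the error at `m` is `≤ A√m log n ≤ (A/c)(n − m) log n`;
at `n`, `√n ≤ √m + (n − m)/(2√m)` gives `≤ (A/c + A/(2s₀))(n − m) log n`. -/
theorem li_lag_lower_bound {A c s₀ : ℝ} (hA : 0 ≤ A) (hc : 0 < c) (hs₀ : 0 < s₀) {m n : ℕ} (hm1 : 1 ≤ m)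
    (hs : s₀ ≤ Real.sqrt m) (hlag : (m : ℝ) + c * Real.sqrt m ≤ n)
    (hm : |keiperLiCoeff m - liMainTerm m| ≤ A * Real.sqrt m * Real.log m)
    (hn : |keiperLiCoeff n - liMainTerm n| ≤ A * Real.sqrt n * Real.log n) :
    ((n : ℝ) - m) * ((1 / 2 - 2 * A / c - A / (2 * s₀)) * Real.log n + liC1) ≤
      keiperLiCoeff n - keiperLiCoeff m := by
  have hm0 : (0 : ℝ) < m := by exact_mod_cast hm1
  have hs_pos : 0 < Real.sqrt m := Real.sqrt_pos.2 hm0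
  have hcs : 0 ≤ c * Real.sqrt m := by positivity
  have hd0 : 0 ≤ (n : ℝ) - m := by linarith
  have hmn : (m : ℝ) ≤ n := by linarith
  have hn1 : (1 : ℝ) ≤ n := le_trans (by exact_mod_cast hm1) hmn
  have hL0 : 0 ≤ Real.log n := Real.log_nonneg hn1
  have hlogmn : Real.log m ≤ Real.log n := Real.log_le_log hm0 hmn
  have hd : Real.sqrt m ≤ ((n : ℝ) - m) / c := by
    rw [le_div_iff₀ hc]; linarith
  -- main term
  have hmain : ((n : ℝ) - m) * (Real.log n / 2) + liC1 * ((n : ℝ) - m) ≤ liMainTerm n - liMainTerm m := by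
    have h1 : (m : ℝ) / 2 * Real.log m ≤ (m : ℝ) / 2 * Real.log n :=
      mul_le_mul_of_nonneg_left hlogmn (by positivity)
    unfold liMainTerm
    linarith
  -- error at `m`
  have herr_m : A * Real.sqrt m * Real.log m ≤ A / c * ((n : ℝ) - m) * Real.log n := by
    have h1 : A * Real.sqrt m * Real.log m ≤ A * Real.sqrt m * Real.log n :=
      mul_le_mul_of_nonneg_left hlogmn (by positivity)
    have h2 : A * Real.sqrt m * Real.log n ≤ A * (((n : ℝ) - m) / c) * Real.log n := by
      apply mul_le_mul_of_nonneg_right _ hL0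
      exact mul_le_mul_of_nonneg_left hd hA
    calc A * Real.sqrt m * Real.log m ≤ A * Real.sqrt m * Real.log n := h1
      _ ≤ A * (((n : ℝ) - m) / c) * Real.log n := h2
      _ = A / c * ((n : ℝ) - m) * Real.log n := by ring
  -- error at `n`
  have hsqrt_n : Real.sqrt n ≤ Real.sqrt m + ((n : ℝ) - m) / (2 * Real.sqrt m) := by
    have h := sqrt_add_le_sqrt_add_div hm0 hd0
    have e : (m : ℝ) + ((n : ℝ) - m) = n := by ring
    rw [e] at h
    exact h
  have herr_n : A * Real.sqrt n * Real.log n ≤ (A / c + A / (2 * s₀)) * ((n : ℝ) - m) * Real.log n := by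
    have h1 : A * Real.sqrt n * Real.log n ≤
        A * (Real.sqrt m + ((n : ℝ) - m) / (2 * Real.sqrt m)) * Real.log n := by
      apply mul_le_mul_of_nonneg_right _ hL0
      exact mul_le_mul_of_nonneg_left hsqrt_n hA
    have h3 : ((n : ℝ) - m) / (2 * Real.sqrt m) ≤ ((n : ℝ) - m) / (2 * s₀) :=
      div_le_div_of_nonneg_left hd0 (by positivity) (by linarith)
    have h4 : A * (Real.sqrt m + ((n : ℝ) - m) / (2 * Real.sqrt m)) * Real.log n ≤
        A * (((n : ℝ) - m) / c + ((n : ℝ) - m) / (2 * s₀)) * Real.log n := by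
      apply mul_le_mul_of_nonneg_right _ hL0
      apply mul_le_mul_of_nonneg_left _ hA
      linarith
    calc A * Real.sqrt n * Real.log n
        ≤ A * (Real.sqrt m + ((n : ℝ) - m) / (2 * Real.sqrt m)) * Real.log n := h1
      _ ≤ A * (((n : ℝ) - m) / c + ((n : ℝ) - m) / (2 * s₀)) * Real.log n := h4
      _ = (A / c + A / (2 * s₀)) * ((n : ℝ) - m) * Real.log n := by ring
  -- combine
  obtain ⟨hm_lo, hm_hi⟩ := abs_le.1 hm
  obtain ⟨hn_lo, hn_hi⟩ := abs_le.1 hn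
  have hgoal : ((n : ℝ) - m) * ((1 / 2 - 2 * A / c - A / (2 * s₀)) * Real.log n + liC1) =
      ((n : ℝ) - m) * (Real.log n / 2) + liC1 * ((n : ℝ) - m) - A / c * ((n : ℝ) - m) * Real.log n -
        (A / c + A / (2 * s₀)) * ((n : ℝ) - m) * Real.log n := by ring
  rw [hgoal]
  linarith

/-! ## §3 The square-root lag law -/

/-- **RH-FREE · AT A VERIFIED HEIGHT (FIN-class input).** If every zero of `ζ` with `0 < Im ρ ≤ T`
(`T ≥ 1000`) lies on the critical line, then `λ_m < λ_n` whenever `3·10⁵ ≤ m` and `m + 3√m ≤ n ≤ T²/4`.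
(Two readings of the leaf `liAsymptoticLawQuadratic_proof`, constant `1/3`; core §2 with `A = 1/3`, `c = 3`,
`s₀ = 500`: coefficient `1/2 − 2/9 − 1/3000`, `log n ≥ 18·log 2 > 12.47`, `C₁ ≥ −5/4`.) -/
theorem li_sqrtLag_monotone_of_rhUpTo {T : ℝ} (hT : 1000 ≤ T) (hRHT : RiemannHypothesisUpTo T) {m n : ℕ}
    (hm : 300000 ≤ m) (hlag : (m : ℝ) + 3 * Real.sqrt m ≤ n) (hnT : (n : ℝ) ≤ 1 / 4 * T ^ 2) :
    keiperLiCoeff m < keiperLiCoeff n := by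
  have hm1 : 1 ≤ m := le_trans (by norm_num) hm
  have hmR : (300000 : ℝ) ≤ m := by exact_mod_cast hm
  have hs : (500 : ℝ) ≤ Real.sqrt m := le_sqrt_of_sq_le (by norm_num) (by nlinarith)
  have hmn : (m : ℝ) ≤ n := by linarith
  have hnN : 300000 ≤ n := by exact_mod_cast hmR.trans hmn
  have hmT : (m : ℝ) ≤ 1 / 4 * T ^ 2 := hmn.trans hnT
  have hbm := (liAsymptoticLawQuadratic_proof hT hRHT hmT).2 hm
  have hbn := (liAsymptoticLawQuadratic_proof hT hRHT hnT).2 hnN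
  have key := li_lag_lower_bound (A := 1 / 3) (c := 3) (s₀ := 500) (by norm_num) (by norm_num) (by norm_num)
    hm1 hs hlag hbm hbn
  have h2 : (2 : ℝ) ^ 18 ≤ n := le_trans (by norm_num) (hmR.trans hmn)
  have hlog := mul_log_two_le_log h2
  push_cast at hlog
  have hC1 := neg_five_fourths_le_liC1
  have hcoef : (2 : ℝ) ≤ (1 / 2 - 2 * (1 / 3) / 3 - 1 / 3 / (2 * 500)) * Real.log n + liC1 := by
    norm_num at hlog ⊢
    linarith
  have hd : (1500 : ℝ) ≤ (n : ℝ) - m := by linarith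
  nlinarith [mul_le_mul hd hcoef (by norm_num) (by linarith)]

/-- **UNCONDITIONAL (RH-free, kernel): lag-`12√m` monotonicity throughout the verified quadratic range.**
For `10⁴ ≤ m` and `m + 12√m ≤ n ≤ 2.5·10⁵`: `λ_m < λ_n`.  Height input: the tree's hypothesis-free
`riemannHypothesisUpTo_1000`; level law with constant `2` (`n ≥ 900`); core §2 with `A = 2`, `c = 12`, `s₀ = 100`:
coefficient `1/2 − 1/3 − 1/100 = 47/300`, `log n ≥ 13·log 2 > 9.01`, `C₁ ≥ −5/4`. -/
theorem li_lag_monotone_upTo_250000 {m n : ℕ} (hm : 10000 ≤ m) (hlag : (m : ℝ) + 12 * Real.sqrt m ≤ n)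
    (hn : n ≤ 250000) : keiperLiCoeff m < keiperLiCoeff n := by
  have hT : (1000 : ℝ) ≤ 1000 := le_rfl
  have hm1 : 1 ≤ m := le_trans (by norm_num) hm
  have hm900 : 900 ≤ m := le_trans (by norm_num) hm
  have hmR : (10000 : ℝ) ≤ m := by exact_mod_cast hm
  have hs : (100 : ℝ) ≤ Real.sqrt m := le_sqrt_of_sq_le (by norm_num) (by nlinarith)
  have hmn : (m : ℝ) ≤ n := by linarith
  have hn900 : 900 ≤ n := by exact_mod_cast (show (900 : ℝ) ≤ n by linarith)
  have hnR : (n : ℝ) ≤ 250000 := by exact_mod_cast hn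
  have hnT : (n : ℝ) ≤ 1 / 4 * (1000 : ℝ) ^ 2 := le_trans hnR (by norm_num)
  have hmT : (m : ℝ) ≤ 1 / 4 * (1000 : ℝ) ^ 2 := hmn.trans hnT
  have hbm := (liAsymptoticLawQuadratic_proof hT riemannHypothesisUpTo_1000 hmT).1 hm900
  have hbn := (liAsymptoticLawQuadratic_proof hT riemannHypothesisUpTo_1000 hnT).1 hn900
  have key := li_lag_lower_bound (A := 2) (c := 12) (s₀ := 100) (by norm_num) (by norm_num) (by norm_num)
    hm1 hs hlag hbm hbn
  have h2 : (2 : ℝ) ^ 13 ≤ n := le_trans (by norm_num) (hmR.trans hmn)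
  have hlog := mul_log_two_le_log h2
  push_cast at hlog
  have hC1 := neg_five_fourths_le_liC1
  have hcoef : (4 / 25 : ℝ) ≤ (1 / 2 - 2 * 2 / 12 - 2 / (2 * 100)) * Real.log n + liC1 := by
    norm_num at hlog ⊢
    linarith
  have hd : (1200 : ℝ) ≤ (n : ℝ) - m := by linarith
  nlinarith [mul_le_mul hd hcoef (by norm_num) (by linarith)]

/-- **ON THE PLATT–TRUDGIAN FACT (cited height `T = 3 000 175 332 800`, carried as a hypothesis, never asserted):**
`λ_m < λ_n` whenever `3·10⁵ ≤ m` and `m + 3√m ≤ n ≤ 2.25·10²⁴`.  RH-FREE implication. -/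
theorem li_sqrtLag_monotone_plattTrudgian (hPT : riemannHypothesisUpTo_platt_trudgian) {m n : ℕ}
    (hm : 300000 ≤ m) (hlag : (m : ℝ) + 3 * Real.sqrt m ≤ n) (hn : n ≤ 2250000000000000000000000) :
    keiperLiCoeff m < keiperLiCoeff n := by
  have hT : (1000 : ℝ) ≤ 3000175332800 := by norm_num
  have hnR : (n : ℝ) ≤ 2250000000000000000000000 := by exact_mod_cast hn
  have hnT : (n : ℝ) ≤ 1 / 4 * (3000175332800 : ℝ) ^ 2 := le_trans hnR (by norm_num)
  exact li_sqrtLag_monotone_of_rhUpTo hT hPT hm hlag hnT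

/-- **RH-CONSEQUENCE · EFFECTIVE: THE SQUARE-ROOT LAG LAW.** Under RH, `λ_m < λ_n` whenever `m ≥ 3·10⁵` and
`n ≥ m + 3√m` — the RH-free law of `li_sqrtLag_monotone_of_rhUpTo` at the height `T = max 1000 (2√n)`,
which RH verifies for every `n`. -/
theorem li_sqrtLag_monotone_of_rh (hRH : _root_.RiemannHypothesis) {m n : ℕ} (hm : 300000 ≤ m)
    (hlag : (m : ℝ) + 3 * Real.sqrt m ≤ n) : keiperLiCoeff m < keiperLiCoeff n := by
  have hT : (1000 : ℝ) ≤ max 1000 (2 * Real.sqrt n) := le_max_left _ _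
  have hRHT := RiemannHypothesisUpTo.of_riemannHypothesis hRH (max 1000 (2 * Real.sqrt n))
  have hnT : (n : ℝ) ≤ 1 / 4 * (max 1000 (2 * Real.sqrt n)) ^ 2 := by
    have h1 : 2 * Real.sqrt n ≤ max 1000 (2 * Real.sqrt n) := le_max_right _ _
    have h2 : (2 * Real.sqrt n) ^ 2 = 4 * n := by
      rw [mul_pow, Real.sq_sqrt (Nat.cast_nonneg n)]; norm_num
    have h3 : (2 * Real.sqrt n) ^ 2 ≤ (max 1000 (2 * Real.sqrt n)) ^ 2 :=
      pow_le_pow_left₀ (by positivity) h1 2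
    linarith
  exact li_sqrtLag_monotone_of_rhUpTo hT hRHT hm hlag hnT

/-- **RH-CONSEQUENCE · WINDOW FORM (scale `√N`; compare the card's §19 M2 at scale `N/log²N`).** Under RH, for
`N ≥ 3·10⁵`, every `n ∈ [N, 2N]` and every lag `k ≥ (9/2)√N`: `λ_n < λ_{n+k}` (`3√n ≤ 3√2·√N < (9/2)√N`). -/
theorem li_sqrtWindow_monotone_of_rh (hRH : _root_.RiemannHypothesis) {N n k : ℕ} (hN : 300000 ≤ N)
    (hNn : N ≤ n) (hn2N : n ≤ 2 * N) (hk : 9 / 2 * Real.sqrt N ≤ k) :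
    keiperLiCoeff n < keiperLiCoeff (n + k) := by
  have hNR : (300000 : ℝ) ≤ N := by exact_mod_cast hN
  have hn : 300000 ≤ n := hN.trans hNn
  have hn2 : (n : ℝ) ≤ 2 * N := by exact_mod_cast hn2N
  have hsN : 0 ≤ Real.sqrt N := Real.sqrt_nonneg _
  have hsqrt : Real.sqrt n ≤ Real.sqrt 2 * Real.sqrt N := by
    rw [← Real.sqrt_mul (by norm_num : (0 : ℝ) ≤ 2)]
    exact Real.sqrt_le_sqrt hn2
  have hs2 : Real.sqrt 2 < 3 / 2 := by
    rw [show (3 / 2 : ℝ) = Real.sqrt ((3 / 2) ^ 2) by rw [Real.sqrt_sq]; norm_num]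
    exact Real.sqrt_lt_sqrt (by norm_num) (by norm_num)
  refine li_sqrtLag_monotone_of_rh hRH hn ?_
  push_cast
  nlinarith [mul_le_mul_of_nonneg_right hs2.le hsN]

/-- **COROLLARY (the dilation law of the card's §19 M1 from the lag law).** Under RH, for every `ε > 0` there is
`m₀` with `λ_m < λ_n` whenever `m ≥ m₀` and `n ≥ (1+ε)m` (`εm ≥ 3√m` once `√m ≥ 3/ε`). -/
theorem li_dilation_monotone_of_rh (hRH : _root_.RiemannHypothesis) {ε : ℝ} (hε : 0 < ε) :
    ∃ m₀ : ℕ, ∀ m : ℕ, m₀ ≤ m → ∀ n : ℕ, (1 + ε) * (m : ℝ) ≤ n → keiperLiCoeff m < keiperLiCoeff n := by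
  obtain ⟨M, hM⟩ := exists_nat_ge ((3 / ε) ^ 2)
  refine ⟨max 300000 M, fun m hm n hmn ↦ ?_⟩
  have hm3 : 300000 ≤ m := le_of_max_le_left hm
  have hmM : (M : ℝ) ≤ m := by exact_mod_cast le_of_max_le_right hm
  have hs : 3 / ε ≤ Real.sqrt m := le_sqrt_of_sq_le (by positivity) (hM.trans hmM)
  have hsm : Real.sqrt m * Real.sqrt m = m := Real.mul_self_sqrt (Nat.cast_nonneg m)
  have h3 : 3 * Real.sqrt m ≤ ε * m := by
    have h1 : 3 ≤ ε * Real.sqrt m := by rwa [div_le_iff₀ hε, mul_comm] at hs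
    nlinarith [Real.sqrt_nonneg (m : ℝ)]
  exact li_sqrtLag_monotone_of_rh hRH hm3 (by linarith)

/-- **THE CONSTANT: an `A√n log n` level law beyond `n₀` gives the lag law at every `c > 4A`** (RH-FREE; with
the tree's `A = 1/3` under RH: every `c > 4/3`).  Core §2 with `s₀ = A/κ₀`, `κ₀ = 1/2 − 2A/c > 0`,
and `m₀` so large that `√m₀ ≥ s₀` and `(κ₀/2) log m₀ > 5/4`. -/
theorem li_lag_monotone_of_level_law {A : ℝ} {n₀ : ℕ} (hA : 0 < A)
    (hlaw : ∀ n : ℕ, n₀ ≤ n → |keiperLiCoeff n - liMainTerm n| ≤ A * Real.sqrt n * Real.log n)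
    {c : ℝ} (hc : 4 * A < c) :
    ∃ m₀ : ℕ, ∀ m : ℕ, m₀ ≤ m → ∀ n : ℕ, (m : ℝ) + c * Real.sqrt m ≤ n →
      keiperLiCoeff m < keiperLiCoeff n := by
  have hc0 : 0 < c := by linarith
  set κ₀ : ℝ := 1 / 2 - 2 * A / c with hκ₀
  have hκ : 0 < κ₀ := by
    rw [hκ₀, sub_pos, div_lt_iff₀ hc0]; linarith
  set s₀ : ℝ := A / κ₀ with hs₀def
  have hs₀ : 0 < s₀ := by positivity
  obtain ⟨M₁, hM₁⟩ := exists_nat_ge (s₀ ^ 2)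
  obtain ⟨M₂, hM₂⟩ := exists_nat_ge (Real.exp (3 / κ₀))
  refine ⟨max (max n₀ 1) (max M₁ M₂), fun m hm n hmn ↦ ?_⟩
  have hmn₀ : n₀ ≤ m := le_trans (le_max_left _ _) (le_of_max_le_left hm)
  have hm1 : 1 ≤ m := le_trans (le_max_right _ _) (le_of_max_le_left hm)
  have hmM₁ : (M₁ : ℝ) ≤ m := by exact_mod_cast le_trans (le_max_left _ _) (le_of_max_le_right hm)
  have hmM₂ : (M₂ : ℝ) ≤ m := by exact_mod_cast le_trans (le_max_right _ _) (le_of_max_le_right hm)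
  have hm0 : (0 : ℝ) < m := by exact_mod_cast hm1
  have hs : s₀ ≤ Real.sqrt m := le_sqrt_of_sq_le hs₀.le (hM₁.trans hmM₁)
  have hmn' : (m : ℝ) ≤ n := by nlinarith [Real.sqrt_nonneg (m : ℝ)]
  have hnn₀ : n₀ ≤ n := by exact_mod_cast (show (n₀ : ℝ) ≤ n from (Nat.cast_le.2 hmn₀).trans hmn')
  have key := li_lag_lower_bound hA.le hc0 hs₀ hm1 hs hmn (hlaw m hmn₀) (hlaw n hnn₀)
  -- the coefficient is κ₀/2
  have hcoefeq : 1 / 2 - 2 * A / c - A / (2 * s₀) = κ₀ / 2 := by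
    rw [hs₀def]
    field_simp
    rw [hκ₀]
    field_simp
    ring
  rw [hcoefeq] at key
  -- log n ≥ log m ≥ 3/κ₀
  have hexp : Real.exp (3 / κ₀) ≤ n := (hM₂.trans hmM₂).trans hmn'
  have hlog : 3 / κ₀ ≤ Real.log n := by
    rw [Real.le_log_iff_exp_le (lt_of_lt_of_le (Real.exp_pos _) hexp)]; exact hexp
  have hC1 := neg_five_fourths_le_liC1
  have hcoef : (1 / 4 : ℝ) ≤ κ₀ / 2 * Real.log n + liC1 := by
    have : (3 : ℝ) ≤ κ₀ * Real.log n := by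
      have := mul_le_mul_of_nonneg_left hlog hκ.le
      rwa [mul_div_cancel₀ _ hκ.ne'] at this
    linarith
  have hd : c * s₀ ≤ (n : ℝ) - m := by nlinarith [mul_le_mul_of_nonneg_left hs hc0.le]
  have hcs : 0 < c * s₀ := by positivity
  nlinarith [mul_le_mul hd hcoef (by norm_num) (by linarith)]

/-! ## §4 The RH-free converse and the relabelling -/

/-- **RH-FREE CONVERSE (Bombieri–Lagarias): one anchored comparison is already RH.** If for SOME index `m` and
some real `B`, `λ_m ≤ λ_n` for every `n ≥ B`, then the Li sequence is bounded below, hence RH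
(tree `riemannHypothesis_of_keiperLiCoeff_bddBelow`, B–L 1999 Thm 1). [cite: BombieriLagarias1999, Theorem 1] -/
theorem rh_of_li_anchor {m : ℕ} {B : ℝ} (h : ∀ n : ℕ, B ≤ (n : ℝ) → keiperLiCoeff m ≤ keiperLiCoeff n) :
    _root_.RiemannHypothesis := by
  obtain ⟨T, hT⟩ := exists_nat_ge B
  set H : ℝ := ∑ k ∈ Finset.range T, |keiperLiCoeff k| with hH
  have hH0 : 0 ≤ H := Finset.sum_nonneg fun k _ ↦ abs_nonneg _
  refine riemannHypothesis_of_keiperLiCoeff_bddBelow (K := H + |keiperLiCoeff m|) fun n _ ↦ ?_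
  by_cases hnT : n < T
  · have hle : |keiperLiCoeff n| ≤ H :=
      Finset.single_le_sum (f := fun k ↦ |keiperLiCoeff k|) (fun k _ ↦ abs_nonneg _)
        (Finset.mem_range.2 hnT)
    have := neg_abs_le (keiperLiCoeff n)
    linarith [abs_nonneg (keiperLiCoeff m)]
  · have hTn : (T : ℝ) ≤ n := by exact_mod_cast not_lt.1 hnT
    have := h n (hT.trans hTn)
    linarith [neg_abs_le (keiperLiCoeff m)]

/-- **RH-FREE: EVERY lag law implies RH** — whatever the lag function `f`, «`λ_m ≤ λ_n` for `m ≥ m₀`,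
`n ≥ m + f(m)`» bounds the Li sequence below (anchor at `m₀`). -/
theorem rh_of_li_lagLaw {f : ℕ → ℝ} {m₀ : ℕ}
    (h : ∀ m : ℕ, m₀ ≤ m → ∀ n : ℕ, (m : ℝ) + f m ≤ n → keiperLiCoeff m ≤ keiperLiCoeff n) :
    _root_.RiemannHypothesis :=
  rh_of_li_anchor (m := m₀) (B := (m₀ : ℝ) + f m₀) fun n hn ↦ h m₀ le_rfl n hn

/-- **RH-EQUIVALENCE (RELABELLING; neither side asserted): RH ⟺ the square-root lag law.** -/
theorem rh_iff_li_sqrtLag :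
    _root_.RiemannHypothesis ↔
      ∃ m₀ : ℕ, ∀ m : ℕ, m₀ ≤ m → ∀ n : ℕ, (m : ℝ) + 3 * Real.sqrt m ≤ n →
        keiperLiCoeff m < keiperLiCoeff n :=
  ⟨fun h ↦ ⟨300000, fun _ hm _ hn ↦ li_sqrtLag_monotone_of_rh h hm hn⟩,
    fun ⟨_, h⟩ ↦ rh_of_li_lagLaw (f := fun m ↦ 3 * Real.sqrt m) fun m hm n hn ↦ (h m hm n hn).le⟩

/-- **RH-EQUIVALENCE for EVERY lag function `f ≥ 3√·` (RELABELLING):** dilation `εm`, windows `C·N/log²N`,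
`c√m` (`c ≥ 3`) — each such monotonicity statement is RH restated; below `3√m` the tree proves only `⟸`. -/
theorem rh_iff_li_lagLaw {f : ℕ → ℝ} (hf : ∀ m : ℕ, 3 * Real.sqrt m ≤ f m) :
    _root_.RiemannHypothesis ↔
      ∃ m₀ : ℕ, ∀ m : ℕ, m₀ ≤ m → ∀ n : ℕ, (m : ℝ) + f m ≤ n → keiperLiCoeff m < keiperLiCoeff n :=
  ⟨fun h ↦ ⟨300000, fun m hm n hn ↦ li_sqrtLag_monotone_of_rh h hm (by linarith [hf m])⟩,
    fun ⟨_, h⟩ ↦ rh_of_li_lagLaw (f := f) fun m hm n hn ↦ (h m hm n hn).le⟩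

end Summit.RiemannHypothesis.RiemannHypothesis.Theorems.Splittings.LiSqrtLagLaw
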